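import Summits.Ventures.Crystal3D.Theorems.StickyWulffConstantNoReconstructionGainExactPrep
import Summits.Ventures.Crystal3D.Theorems.StickyWulffConstantCoaxialWallLawFrame
import Summits.Ventures.Crystal3D.Theorems.StickyWulffConstantNoReconstructionGainExactFilmAboveCutAll
import Summits.Ventures.Crystal3D.Theorems.StickyWulffConstantNoReconstructionGainExactCutAlignment
import HarnessLib

/-!
# Exact replication for LOCAL film classes: the local licence (line `replication-exactness`)

HONEST FRAMING. Part of the venture `Summits/Ventures/Crystal3D` (cell `crystal3d-full`), supports the
crux `NoReconstructionGain` (stmt-Ventures-19144, route `route-Ventures-StickyWulffConstant`), line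
`replication-exactness` (lead wulff-p1 g18).  `not_isCriminal_of_classAtom` (`…ExactClassReplication`)
needs a class of POSITIONS containing `Λ₀` (its lattice body is thickened upward); LOCAL film properties
(coordination, bond registry in a rotated frame, …) would be violated by on-lattice filler balls.  Here
the thickening is removed: the cuts of the translated copies are ALIGNED with the top level `−R` of the
exact slab sample — the lattice heights `{⟪t,ν⟫ : t ∈ Λ₀}` form a dense or cyclic subgroup of `ℝ`
(`exists_cut_alignment`, `…ExactCutAlignment`) — and a film lies strictly above its cut
(`IsFilmOn.lt_inner`), so copies cut just below `−R` still lie strictly above `−R`.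

* `not_isCriminal_of_localAtom` — **local licence**: `Pf` invariant under `Λ₀`-translations and
  inherited by unions of copies pairwise `> 1` apart; if at `ν` the adhesion atom (`R ≥ 1`, `C`) holds
  for every unit packing `X ⊇ P_ρ(ν,R)` whose film has `Pf` and lies strictly above `−R`, then no film
  with `Pf` is a criminal on any `H(ν,s)` (`M(D(Q)+1) ≤ M·plugs ≤ #cross ≤ D(F) + Cρ = M·D(Q) + Cρ`).

WHAT THIS IS NOT: instantiations (rotated grains, coordination rungs) follow separately; the crux and
rung F-C1 are not moved.
-/

noncomputable section

namespace Summit.Ventures.Crystal3D.Theorems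

open Summit.Ventures.Crystal3D
open Literature.MathematicalPhysics.StatisticalMechanics (fccStacking isHaggSeq_const
  le_dist_of_mem_barlowStacking_ideal contactDeficiency)
open scoped InnerProductSpace
open Finset

/-! ## The local licence -/

/-- **Local replication licence.**  `Pf` a property of finite films, invariant under `Λ₀`-translations
and inherited by unions of films pairwise more than `1` apart; if at the unit normal `ν` the adhesion atom
(constants `R ≥ 1`, `C`) holds for every unit packing `X ⊇ P` around the EXACT slab sample
`P = P_ρ(ν,R)` whose film `X ∖ P` satisfies `Pf` and lies strictly above the level `−R`, then no film
with `Pf` is a criminal on any half-crystal `H(ν,s)`. -/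
theorem not_isCriminal_of_localAtom {Pf : Finset (EuclideanSpace ℝ (Fin 3)) → Prop}
    (htrans : ∀ Q, Pf Q → ∀ t ∈ fccStacking 1 (Real.sqrt (2 / 3)), Pf (Q.image fun q => q + t))
    (hunion : ∀ (T : Finset (EuclideanSpace ℝ (Fin 3)))
      (G : EuclideanSpace ℝ (Fin 3) → Finset (EuclideanSpace ℝ (Fin 3))),
      (∀ t ∈ T, Pf (G t)) → (∀ t ∈ T, ∀ t' ∈ T, t ≠ t' → ∀ y ∈ G t, ∀ y' ∈ G t', 1 < dist y y') →
      Pf (T.biUnion G))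
    {ν : EuclideanSpace ℝ (Fin 3)} (hν : ‖ν‖ = 1) {R C : ℝ} (hR : 1 ≤ R)
    (hatom : ∀ ρ : ℝ, R ≤ ρ → ∀ X P : Finset (EuclideanSpace ℝ (Fin 3)),
      (∀ p ∈ X, ∀ q ∈ X, p ≠ q → 1 ≤ dist p q) → P ⊆ X →
      (∀ p, p ∈ P ↔ (p ∈ fccStacking 1 (Real.sqrt (2 / 3)) ∧ -(2 * R) ≤ ⟪p, ν⟫_ℝ ∧
        ⟪p, ν⟫_ℝ ≤ -R ∧ ‖p‖ ^ 2 - ⟪p, ν⟫_ℝ ^ 2 ≤ ρ ^ 2)) →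
      Pf (X \ P) → (∀ q ∈ X \ P, -R < ⟪q, ν⟫_ℝ) →
      ((((P ×ˢ (X \ P)).filter fun pq => dist pq.1 pq.2 = 1).card : ℕ) : ℝ) ≤
        contactDeficiency (X \ P) + C * ρ)
    {s : ℝ} {Q : Finset (EuclideanSpace ℝ (Fin 3))} (hQP : Pf Q) : ¬ IsCriminal ν s Q := by
  classical
  intro hcrim
  -- (0) align the cut with the level `−R`
  obtain ⟨s₁, hsame, halign⟩ := exists_cut_alignment hν s (-R)
  have hplugSet : ∀ q, plugSet ν s₁ q = plugSet ν s q := by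
    intro q; ext z
    constructor
    · rintro ⟨⟨hzΛ, hzc⟩, hzd⟩; exact ⟨⟨hzΛ, (hsame z hzΛ).2 hzc⟩, hzd⟩
    · rintro ⟨⟨hzΛ, hzc⟩, hzd⟩; exact ⟨⟨hzΛ, (hsame z hzΛ).1 hzc⟩, hzd⟩
  have hplug₁ : ∀ U : Finset (EuclideanSpace ℝ (Fin 3)), plugCount ν s₁ U = plugCount ν s U := by
    intro U; unfold plugCount; exact Finset.sum_congr rfl fun q _ => by rw [hplugSet q]
  obtain ⟨hQ₀, hne, hcore⟩ := hcrim
  have hQ : IsFilmOn ν s₁ Q :=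
    ⟨hQ₀.1, fun q hq z hz => hQ₀.2 q hq z ⟨hz.1, (hsame z hz.1).2 hz.2⟩⟩
  -- (1) the gain and the film's constants
  have hgain : contactDeficiency Q < plugCount ν s₁ Q := by
    have h1 := hcore Q (Finset.Subset.refl Q) hne
    simp only [Finset.sdiff_self, Finset.empty_product, Finset.filter_empty, Finset.card_empty,
      Nat.cast_zero, add_zero] at h1
    rw [hplug₁]; exact h1
  have hint := contactDeficiency_add_one_le_plugCount hgain
  obtain ⟨δ, hδ, hδ1, hslack⟩ := exists_film_slack ν s₁ Q
  -- the film lies strictly above its cut: margin `μ`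
  obtain ⟨q₀, hq₀, hq₀min⟩ := Finset.exists_min_image Q (fun q => ⟪q, ν⟫_ℝ) hne
  set μ : ℝ := ⟪q₀, ν⟫_ℝ - s₁ with hμ
  have hμ0 : 0 < μ := by have := IsFilmOn.lt_inner hν hQ hq₀; rw [hμ]; linarith only [this]
  have hμQ : ∀ q ∈ Q, s₁ + μ ≤ ⟪q, ν⟫_ℝ := by
    intro q hq; have := hq₀min q hq; rw [hμ]; linarith only [this]
  set δ₀ : ℝ := min δ μ with hδ₀
  have hδ₀0 : 0 < δ₀ := lt_min hδ hμ0
  have hδ₀δ : δ₀ ≤ δ := min_le_left _ _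
  have hδ₀μ : δ₀ ≤ μ := min_le_right _ _
  obtain ⟨t₀, ht₀Λ, η, hη, hη1, hwin⟩ := halign δ₀ hδ₀0 (hδ₀δ.trans hδ1)
  set Dq : ℝ := ∑ q ∈ Q, ‖q‖ with hDq
  have hDq0 : 0 ≤ Dq := Finset.sum_nonneg fun q _ => norm_nonneg q
  have hqDq : ∀ q ∈ Q, ‖q‖ ≤ Dq := fun q hq =>
    Finset.single_le_sum (f := fun q => ‖q‖) (fun q _ => norm_nonneg q) hq
  obtain ⟨m, hm⟩ : ∃ m : ℕ, m = ⌈2 * Dq + 2⌉₊ + 1 := ⟨_, rfl⟩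
  have hm1 : 1 ≤ m := by rw [hm]; exact Nat.le_add_left 1 _
  have hmR : 2 * Dq + 2 ≤ (m : ℝ) := by
    rw [hm]; push_cast; linarith [Nat.le_ceil (2 * Dq + 2)]
  -- (2) flat translations with height window `η`
  obtain ⟨c, hc, ρ₀, hρ₀, hflat⟩ := exists_flatTranslations ν hν η hη hη1 m hm1
  -- (3) the radius
  set ρ' : ℝ := max (max R (4 * ρ₀)) (max (2 * (Dq + ‖t₀‖ + 2)) (16 * |C| / c + 1)) with hρ'
  have hρ'R : R ≤ ρ' := le_max_of_le_left (le_max_left _ _)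
  have hρ'ρ₀ : ρ₀ ≤ ρ' / 4 := by
    have : 4 * ρ₀ ≤ ρ' := le_max_of_le_left (le_max_right _ _); linarith only [this]
  have hρ'lat : Dq + ‖t₀‖ + 2 ≤ ρ' / 2 := by
    have : 2 * (Dq + ‖t₀‖ + 2) ≤ ρ' := le_max_of_le_right (le_max_left _ _)
    linarith only [this]
  have hρ'c : 16 * |C| / c + 1 ≤ ρ' := le_max_of_le_right (le_max_right _ _)
  have hρ'pos : 0 < ρ' := lt_of_lt_of_le (by linarith only [hR]) hρ'R
  obtain ⟨T, hTΛ, hTnorm, hTsep, ⟨a, -, hTwin⟩, hTcard⟩ := hflat (ρ' / 4) hρ'ρ₀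
  -- (4) re-centre the translations at some `t⋆ ∈ T`
  have hTne : T.Nonempty := by
    rw [← Finset.card_pos]
    have h1 : (0 : ℝ) < T.card := lt_of_lt_of_le (by positivity) hTcard
    exact_mod_cast h1
  obtain ⟨tc, htc⟩ := hTne
  set t₁ : EuclideanSpace ℝ (Fin 3) := t₀ - tc with ht₁
  have ht₁Λ : t₁ ∈ fccStacking 1 (Real.sqrt (2 / 3)) := fcc_sub_site_mem ht₀Λ (hTΛ tc htc)
  have hτΛ : ∀ t ∈ T, t₁ + t ∈ fccStacking 1 (Real.sqrt (2 / 3)) :=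
    fun t ht => fcc_add_site_mem ht₁Λ (hTΛ t ht)
  have hτnorm : ∀ t ∈ T, ‖t₁ + t‖ ≤ ‖t₀‖ + ρ' / 2 := by
    intro t ht
    have e : t₁ + t = t₀ + (t - tc) := by rw [ht₁]; abel
    rw [e]
    calc ‖t₀ + (t - tc)‖ ≤ ‖t₀‖ + ‖t - tc‖ := norm_add_le _ _
      _ ≤ ‖t₀‖ + (‖t‖ + ‖tc‖) := add_le_add le_rfl (norm_sub_le _ _)
      _ ≤ ‖t₀‖ + (ρ' / 4 + ρ' / 4) := add_le_add le_rfl (add_le_add (hTnorm t ht) (hTnorm tc htc))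
      _ = ‖t₀‖ + ρ' / 2 := by ring
  -- the cuts of the copies lie in `(−R − δ₀, −R]`
  have hcut : ∀ t ∈ T, -R - δ₀ < s₁ + ⟪t₁ + t, ν⟫_ℝ ∧ s₁ + ⟪t₁ + t, ν⟫_ℝ ≤ -R := by
    intro t ht
    have hd : t - tc ∈ fccStacking 1 (Real.sqrt (2 / 3)) := fcc_sub_site_mem (hTΛ t ht) (hTΛ tc htc)
    have hh : |⟪t - tc, ν⟫_ℝ| < η := by
      obtain ⟨h1, h2⟩ := hTwin t ht
      obtain ⟨h3, h4⟩ := hTwin tc htc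
      rw [inner_sub_left, abs_lt]
      constructor <;> linarith only [h1, h2, h3, h4]
    have e : t₁ + t = t₀ + (t - tc) := by rw [ht₁]; abel
    rw [e]
    exact hwin (t - tc) hd hh
  -- (5) the exact slab sample
  obtain ⟨P, hP⟩ := exists_latticeBody ν (-(2 * R)) (-R) ρ'
  -- (6) the copies
  set G : EuclideanSpace ℝ (Fin 3) → Finset (EuclideanSpace ℝ (Fin 3)) :=
    fun t => Q.image fun q => q + (t₁ + t) with hG
  set F := T.biUnion G with hF
  have hfilm : ∀ t ∈ T, IsFilmOn ν (s₁ + ⟪t₁ + t, ν⟫_ℝ) (G t) :=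
    fun t ht => isFilmOn_translate (hτΛ t ht) hQ
  have hpc : ∀ t ∈ T, plugCount ν (s₁ + ⟪t₁ + t, ν⟫_ℝ) (G t) = plugCount ν s₁ Q :=
    fun t ht => plugCount_translate (hτΛ t ht) s₁ Q
  have hDG : ∀ t, contactDeficiency (G t) = contactDeficiency Q :=
    fun t => contactDeficiency_translate _ Q
  have hPG : ∀ t ∈ T, Pf (G t) := fun t ht => htrans Q hQP _ (hτΛ t ht)
  have hGmem : ∀ t y, y ∈ G t ↔ ∃ q ∈ Q, y = q + (t₁ + t) := by
    intro t y
    rw [hG, Finset.mem_image]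
    constructor
    · rintro ⟨q, hq, rfl⟩; exact ⟨q, hq, rfl⟩
    · rintro ⟨q, hq, rfl⟩; exact ⟨q, hq, rfl⟩
  have hGnorm : ∀ t ∈ T, ∀ y ∈ G t, ‖y‖ ≤ Dq + ‖t₀‖ + ρ' / 2 := by
    intro t ht y hy
    obtain ⟨q, hq, rfl⟩ := (hGmem t y).1 hy
    calc ‖q + (t₁ + t)‖ ≤ ‖q‖ + ‖t₁ + t‖ := norm_add_le _ _
      _ ≤ Dq + (‖t₀‖ + ρ' / 2) := add_le_add (hqDq q hq) (hτnorm t ht)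
      _ = Dq + ‖t₀‖ + ρ' / 2 := by ring
  -- film balls lie at least `μ` above their cut, hence strictly above `−R`
  have hGheight : ∀ t ∈ T, ∀ y ∈ G t, -R < ⟪y, ν⟫_ℝ := by
    intro t ht y hy
    obtain ⟨q, hq, rfl⟩ := (hGmem t y).1 hy
    have h1 := hμQ q hq
    rw [inner_add_left]
    linarith only [h1, (hcut t ht).1, hδ₀μ]
  -- (7) distances
  have hfarGG : ∀ t ∈ T, ∀ t' ∈ T, t ≠ t' → ∀ y ∈ G t, ∀ y' ∈ G t', 1 < dist y y' := by
    intro t ht t' ht' hne y hy y' hy'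
    obtain ⟨q, hq, rfl⟩ := (hGmem t y).1 hy
    obtain ⟨q', hq', rfl⟩ := (hGmem t' y').1 hy'
    have hsep := hTsep t ht t' ht' hne
    rw [dist_eq_norm] at hsep ⊢
    have e : q + (t₁ + t) - (q' + (t₁ + t')) = (t - t') + (q - q') := by abel
    rw [e]
    have h1 : ‖t - t'‖ - ‖q - q'‖ ≤ ‖(t - t') + (q - q')‖ := by
      have h3 := norm_sub_norm_le (t - t') (-(q - q'))
      rwa [norm_neg, sub_neg_eq_add] at h3
    have h2 : ‖q - q'‖ ≤ 2 * Dq := by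
      calc ‖q - q'‖ ≤ ‖q‖ + ‖q'‖ := norm_sub_le _ _
        _ ≤ Dq + Dq := add_le_add (hqDq q hq) (hqDq q' hq')
        _ = 2 * Dq := by ring
    linarith only [hsep, h1, h2, hmR]
  have hdisjGG : ∀ t ∈ T, ∀ t' ∈ T, t ≠ t' → Disjoint (G t) (G t') := by
    intro t ht t' ht' hne
    rw [Finset.disjoint_left]
    intro y hy hy'
    have := hfarGG t ht t' ht' hne y hy y hy'
    rw [dist_self] at this; linarith only [this]
  have hPGd : ∀ z ∈ P, ∀ t ∈ T, ∀ y ∈ G t, 1 ≤ dist z y := by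
    intro z hz t ht y hy
    obtain ⟨hzΛ, -, hzhi, -⟩ := (hP z).1 hz
    by_cases hzc : ⟪z, ν⟫_ℝ ≤ s₁ + ⟪t₁ + t, ν⟫_ℝ
    · rw [dist_comm]; exact (hfilm t ht).2 y hy z ⟨hzΛ, hzc⟩
    · push Not at hzc
      obtain ⟨q, hq, rfl⟩ := (hGmem t y).1 hy
      have hz' : z - (t₁ + t) ∈ fccStacking 1 (Real.sqrt (2 / 3)) := fcc_sub_site_mem hzΛ (hτΛ t ht)
      have h1 : s₁ < ⟪z - (t₁ + t), ν⟫_ℝ := by rw [inner_sub_left]; linarith only [hzc]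
      have h2 : ⟪z - (t₁ + t), ν⟫_ℝ ≤ s₁ + δ := by
        rw [inner_sub_left]; linarith only [hzhi, (hcut t ht).1, hδ₀δ]
      have h3 := hslack _ hz' h1 h2 q hq
      have e : dist (q + (t₁ + t)) z = dist q (z - (t₁ + t)) := by
        rw [dist_eq_norm, dist_eq_norm]; congr 1; abel
      rw [dist_comm, e]; exact h3
  have hPP : ∀ z ∈ P, ∀ z' ∈ P, z ≠ z' → 1 ≤ dist z z' := fun z hz z' hz' hne =>
    le_dist_of_mem_barlowStacking_ideal isHaggSeq_const one_pos fcc_height_sq ((hP z).1 hz).1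
      ((hP z').1 hz').1 hne
  have hFmem : ∀ y, y ∈ F ↔ ∃ t ∈ T, y ∈ G t := by
    intro y; rw [hF, Finset.mem_biUnion]
  set X := P ∪ F with hX
  have hXpack : ∀ p ∈ X, ∀ q ∈ X, p ≠ q → 1 ≤ dist p q := by
    intro p hp q hq hne
    rw [hX, Finset.mem_union] at hp hq
    rcases hp with hp | hp <;> rcases hq with hq | hq
    · exact hPP p hp q hq hne
    · obtain ⟨t, ht, hqt⟩ := (hFmem q).1 hq
      exact hPGd p hp t ht q hqt
    · obtain ⟨t, ht, hpt⟩ := (hFmem p).1 hp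
      rw [dist_comm]; exact hPGd q hq t ht p hpt
    · obtain ⟨t, ht, hpt⟩ := (hFmem p).1 hp
      obtain ⟨t', ht', hqt⟩ := (hFmem q).1 hq
      by_cases htt : t = t'
      · subst htt
        exact (hfilm t ht).1 p hpt q hqt hne
      · exact (hfarGG t ht t' ht' htt p hpt q hqt).le
  have hPFdisj : Disjoint P F := by
    rw [Finset.disjoint_left]
    intro z hz hzF
    obtain ⟨t, ht, hzt⟩ := (hFmem z).1 hzF
    have := hPGd z hz t ht z hzt
    rw [dist_self] at this; linarith only [this]
  have hXP : X \ P = F := by rw [hX, Finset.union_sdiff_cancel_left hPFdisj]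
  have hPX : P ⊆ X := by rw [hX]; exact Finset.subset_union_left
  have hPF : Pf F := hunion T G hPG hfarGG
  have hFabove : ∀ q ∈ F, -R < ⟪q, ν⟫_ℝ := by
    intro q hq
    obtain ⟨t, ht, hqt⟩ := (hFmem q).1 hq
    exact hGheight t ht q hqt
  -- (8) the atom
  have hA := hatom ρ' hρ'R X P hXpack hPX hP (by rw [hXP]; exact hPF) (by rw [hXP]; exact hFabove)
  rw [hXP] at hA
  -- (9) deficiency of the film and the cross count
  have hDF : contactDeficiency F = T.card * contactDeficiency Q := by
    rw [hF, contactDeficiency_biUnion_of_far T G hfarGG]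
    simp only [hDG, Finset.sum_const, nsmul_eq_mul]
  have hcross : (T.card : ℝ) * plugCount ν s₁ Q ≤
      ((((P ×ˢ F).filter fun pq => dist pq.1 pq.2 = 1).card : ℕ) : ℝ) := by
    rw [hF, card_cross_biUnion P T G hdisjGG]
    push_cast
    have : ∀ t ∈ T, (plugCount ν s₁ Q : ℝ) ≤
        ((((P ×ˢ G t).filter fun pq => dist pq.1 pq.2 = 1).card : ℕ) : ℝ) := by
      intro t ht
      rw [← hpc t ht, card_cross_eq_sum, plugCount]
      push_cast
      refine Finset.sum_le_sum fun y hy => ?_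
      -- every plug site of the copy lies in the sample
      have hsub : ∀ z ∈ plugSet ν (s₁ + ⟪t₁ + t, ν⟫_ℝ) y, z ∈ P := by
        intro z hz
        obtain ⟨⟨hzΛ, hzc⟩, hzd⟩ := hz
        have hyh := hGheight t ht y hy
        have hyn := hGnorm t ht y hy
        have hzh : ⟪y, ν⟫_ℝ - 1 ≤ ⟪z, ν⟫_ℝ := by
          have := (le_abs_self _).trans (abs_inner_sub_le_dist hν y z)
          rw [hzd] at this; linarith only [this]
        refine (hP z).2 ⟨hzΛ, by linarith only [hzh, hyh, hR], hzc.trans (hcut t ht).2, ?_⟩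
        have hz1 : ‖z‖ ≤ ‖y‖ + 1 := by
          have := norm_sub_norm_le z y
          rw [← dist_eq_norm, dist_comm, hzd] at this; linarith only [this]
        have hz2 : ‖z‖ ≤ ρ' := by linarith only [hz1, hyn, hρ'lat]
        have hzz : ‖z‖ ^ 2 ≤ ρ' ^ 2 := by
          rw [pow_two, pow_two]; exact mul_le_mul hz2 hz2 (norm_nonneg z) hρ'pos.le
        linarith only [hzz, sq_nonneg ⟪z, ν⟫_ℝ]
      exact_mod_cast plugSet_ncard_le_card_filter ν _ P y hsub
    calc (T.card : ℝ) * plugCount ν s₁ Q = ∑ t ∈ T, (plugCount ν s₁ Q : ℝ) := by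
          rw [Finset.sum_const, nsmul_eq_mul]
      _ ≤ _ := Finset.sum_le_sum this
  -- (10) counting: `c ρ'²/16 ≤ #T ≤ C ρ'`
  have hM : c * (ρ' / 4) ^ 2 ≤ T.card := hTcard
  have hprod : (T.card : ℝ) * (contactDeficiency Q + 1) ≤ (T.card : ℝ) * plugCount ν s₁ Q :=
    mul_le_mul_of_nonneg_left hint (Nat.cast_nonneg _)
  have hkey : (T.card : ℝ) ≤ C * ρ' := by
    linarith only [hA, hDF, hcross, hprod]
  have h2 : C * ρ' ≤ |C| * ρ' := mul_le_mul_of_nonneg_right (le_abs_self C) hρ'pos.le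
  have h3 : c * ρ' / 16 ≤ |C| := by
    have : c * (ρ' / 4) ^ 2 = (c * ρ' / 16) * ρ' := by ring
    rw [this] at hM
    exact le_of_mul_le_mul_right (hM.trans (hkey.trans h2)) hρ'pos
  have h4 : ρ' ≤ 16 * |C| / c := by
    rw [le_div_iff₀ hc]
    calc ρ' * c = 16 * (c * ρ' / 16) := by ring
      _ ≤ 16 * |C| := mul_le_mul_of_nonneg_left h3 (by norm_num)
  exact not_le.2 (lt_add_one (16 * |C| / c)) (hρ'c.trans h4)

end Summit.Ventures.Crystal3D.Theorems

end
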